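import Mathlib
import Summits.ValiantsHypothesis.ValiantsHypothesis.Theorems.MonotoneRestorationOrbitRestorationQPLinNL
import HarnessLib

/-!
# Clean minimal `ΣΠΣ(k)` representations and the matching of their cluster sums (ORBIT currency)

Route MonotoneRestoration, crux `OrbitRestorationQP` (stmt-ValiantsHypothesis-18293), line `depth-three-rung`, registered stub
`stub_sigmaPiSigmaKValue` (A_k).  Namespace `Summit.ValiantsHypothesis.ValiantsHypothesis.Theorems.LevelRep`.  Route-independent.

Layer L5 (a) of the formalisation plan of `Cruxes/OrbitRestorationQP/Lines/depth-three-rung-stubA-bounded-fanin.md` (§2 (a)–(b)):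

* `CleanRep f D` — a MINIMAL representation `f = Σ_{i<m} a_i Π L_i` by nonzero scalars and NORMALISED multisets of at most `D`
  polynomials of degree `1`, no nonempty sub-sum vanishing; `exists_cleanRep` extracts one with `m ≤ k` from any representation of
  `f ≠ 0` by `k` scaled products of affine forms (absorb constants, normalise, pass to a sub-family of minimal size).
* `clusterSum R cl a` — the sum of the terms with label `a`; `sum_clusterSum`.

The matching of cluster sums under a symmetry is `…LevelMatch.lean`.  Everything is proved. [folklore; cite: KarninShpilka2009, §3]
-/

noncomputable section

open MvPolynomial

-- `Summit.ValiantsHypothesis.ValiantsHypothesis.…` is the tree's single-conjunct layout (Sub = Summit).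
set_option linter.dupNamespace false

namespace Summit.ValiantsHypothesis.ValiantsHypothesis.Theorems

namespace LevelRep

open RankDistance LinNL

variable {K : Type} [Field K] {V : Type} [Fintype V] [DecidableEq V] [DecidableEq (MvPolynomial V K)]

/-! ### Clean representations -/

/-- A CLEAN MINIMAL representation of `f` by scaled products of normalised degree-`1` polynomials, at most `D` per term: nonzero
scalars, no nonempty sub-sum vanishes. [folklore] -/
structure CleanRep (f : MvPolynomial V K) (D : ℕ) where
  /-- number of terms -/
  m : ℕ
  /-- scalars -/
  a : Fin m → K
  /-- factor multisets -/
  L : Fin m → Multiset (MvPolynomial V K)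
  ha : ∀ i, a i ≠ 0
  hdeg : ∀ i, ∀ q ∈ L i, q.totalDegree = 1
  hnrm : ∀ i, IsNormalised (L i)
  hcard : ∀ i, Multiset.card (L i) ≤ D
  hsum : ∑ i, C (a i) * (L i).prod = f
  hmin : ∀ I : Finset (Fin m), I.Nonempty → ∑ i ∈ I, C (a i) * (L i).prod ≠ 0

namespace CleanRep

variable {f : MvPolynomial V K} {D : ℕ} (R : CleanRep f D)

/-- The `i`-th term. [folklore] -/
def T (i : Fin R.m) : MvPolynomial V K := C (R.a i) * (R.L i).prod

omit [Fintype V] [DecidableEq V] [DecidableEq (MvPolynomial V K)] in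
/-- Terms are nonzero. [folklore] -/
theorem T_ne_zero (i : Fin R.m) : R.T i ≠ 0 := by
  have := R.hmin {i} ⟨i, Finset.mem_singleton_self i⟩
  simpa [T] using this

omit [Fintype V] [DecidableEq V] [DecidableEq (MvPolynomial V K)] in
/-- Members of the factor multisets are nonzero. [folklore] -/
theorem ne_zero_of_mem {i : Fin R.m} {q : MvPolynomial V K} (hq : q ∈ R.L i) : q ≠ 0 := by
  intro h
  have := R.hdeg i q hq
  rw [h, totalDegree_zero] at this
  exact zero_ne_one this

omit [Fintype V] [DecidableEq V] [DecidableEq (MvPolynomial V K)] in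
/-- Associated members of (possibly different) factor multisets are equal. [folklore] -/
theorem eq_of_associated {i j : Fin R.m} {q q' : MvPolynomial V K} (hq : q ∈ R.L i) (hq' : q' ∈ R.L j)
    (h : Associated q q') : q = q' := by
  rw [← R.hnrm i q hq, ← R.hnrm j q' hq', nrm_eq_of_associated h]

/-- The cluster sum of the label `a`. [folklore] -/
def clusterSum {α : Type*} [DecidableEq α] (cl : Fin R.m → α) (a : α) : MvPolynomial V K :=
  ∑ i ∈ Finset.univ.filter (fun i => cl i = a), R.T i

omit [Fintype V] [DecidableEq V] [DecidableEq (MvPolynomial V K)] in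
/-- A cluster sum with nonempty fibre is nonzero. [folklore] -/
theorem clusterSum_ne_zero {α : Type*} [DecidableEq α] (cl : Fin R.m → α) {a : α} (h : ∃ i, cl i = a) :
    R.clusterSum cl a ≠ 0 := by
  obtain ⟨i, hi⟩ := h
  exact R.hmin _ ⟨i, by simp [hi]⟩

omit [Fintype V] [DecidableEq V] [DecidableEq (MvPolynomial V K)] in
/-- A cluster sum with empty fibre is zero. [folklore] -/
theorem clusterSum_eq_zero {α : Type*} [DecidableEq α] (cl : Fin R.m → α) {a : α} (h : ¬ ∃ i, cl i = a) :
    R.clusterSum cl a = 0 := by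
  unfold clusterSum
  rw [Finset.filter_eq_empty_iff.2 (fun i _ hi => h ⟨i, hi⟩), Finset.sum_empty]

omit [Fintype V] [DecidableEq V] [DecidableEq (MvPolynomial V K)] in
/-- `f` is the sum of its cluster sums over the labels. [folklore] -/
theorem sum_clusterSum {α : Type*} [Fintype α] [DecidableEq α] (cl : Fin R.m → α) : ∑ a, R.clusterSum cl a = f := by
  unfold clusterSum
  rw [Finset.sum_fiberwise Finset.univ cl fun i => R.T i]
  exact R.hsum

end CleanRep

/-! ### Existence of a clean representation -/

omit [Fintype V] [DecidableEq V] [DecidableEq (MvPolynomial V K)] in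
/-- Absorbing the constant factors: a scaled product of polynomials of degree `≤ 1` is a scaled product of its degree-`1` members.
[folklore] -/
theorem exists_absorb (a : K) (L : Multiset (MvPolynomial V K)) (hL : ∀ q ∈ L, q.totalDegree ≤ 1) :
    ∃ a' : K, C a * L.prod = C a' * (L.filter fun q => q.totalDegree = 1).prod := by
  classical
  set M := L.filter fun q => ¬ q.totalDegree = 1 with hM
  have hMc : ∀ q ∈ M, q = C (coeff 0 q) := fun q hq => by
    obtain ⟨hqL, hq1⟩ := Multiset.mem_filter.1 hq
    have : q.totalDegree = 0 := by have := hL q hqL; omega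
    exact totalDegree_eq_zero_iff_eq_C.1 this
  have hMeq : M.map (fun q => C (coeff 0 q)) = M := by
    conv_rhs => rw [← Multiset.map_id M]
    exact Multiset.map_congr rfl fun q hq => (hMc q hq).symm
  have hMprod : M.prod = C (M.map (coeff 0)).prod := by
    calc M.prod = (M.map fun q => C (coeff 0 q)).prod := by rw [hMeq]
      _ = C (M.map (coeff 0)).prod := by rw [map_multiset_prod, Multiset.map_map]; rfl
  refine ⟨a * (M.map (coeff 0)).prod, ?_⟩
  conv_lhs => rw [← Multiset.filter_add_not (fun q => q.totalDegree = 1) L, Multiset.prod_add]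
  rw [← hM, hMprod, map_mul]
  ring

omit [Fintype V] [DecidableEq V] [DecidableEq (MvPolynomial V K)] in
/-- Normalising the factors costs a nonzero scalar. [folklore] -/
theorem exists_normalise (L : Multiset (MvPolynomial V K)) :
    ∃ v : K, v ≠ 0 ∧ L.prod = C v * (L.map nrm).prod := by
  have hrel : Multiset.Rel Associated (L.map nrm) L := by
    rw [Multiset.rel_map_left]
    exact Multiset.rel_refl_of_refl_on fun q _ => nrm_associated q
  obtain ⟨w, hw⟩ := prod_associated_of_rel hrel
  obtain ⟨v, hv, hwv⟩ := MvPolynomial.isUnit_iff_eq_C_of_isReduced.1 w.isUnit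
  refine ⟨v, hv.ne_zero, ?_⟩
  rw [← hw, hwv, mul_comm]

omit [Fintype V] [DecidableEq V] in
/-- **Every representation of `f` by `k` scaled products of at most `D` polynomials of degree `≤ 1` can be cleaned**: there is a
clean minimal representation with at most `k` terms (absorb constants, normalise, pass to a sub-family of minimal size; for `f = 0`
it is empty). [folklore] -/
theorem exists_cleanRep {k D : ℕ} {f : MvPolynomial V K} (a : Fin k → K)
    (L : Fin k → Multiset (MvPolynomial V K)) (hL : ∀ i, ∀ q ∈ L i, q.totalDegree ≤ 1)
    (hcard : ∀ i, Multiset.card (L i) ≤ D) (hsum : f = ∑ i, C (a i) * (L i).prod) :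
    ∃ R : CleanRep f D, R.m ≤ k := by
  classical
  -- absorb constants and normalise
  choose a₁ ha₁ using fun i => exists_absorb (a i) (L i) (hL i)
  set L₁ : Fin k → Multiset (MvPolynomial V K) := fun i => (L i).filter fun q => q.totalDegree = 1 with hL₁
  choose v hv0 hv using fun i => exists_normalise (L₁ i)
  set L₂ : Fin k → Multiset (MvPolynomial V K) := fun i => (L₁ i).map nrm with hL₂
  set a₂ : Fin k → K := fun i => a₁ i * v i with ha₂
  have hT : ∀ i, C (a i) * (L i).prod = C (a₂ i) * (L₂ i).prod := fun i => by
    rw [ha₁ i]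
    show C (a₁ i) * (L₁ i).prod = C (a₁ i * v i) * ((L₁ i).map nrm).prod
    rw [hv i, map_mul]; ring
  have hdeg₂ : ∀ i, ∀ q ∈ L₂ i, q.totalDegree = 1 := fun i q hq => by
    obtain ⟨q', hq', rfl⟩ := Multiset.mem_map.1 hq
    rw [totalDegree_nrm]
    exact (Multiset.mem_filter.1 hq').2
  have hnrm₂ : ∀ i, IsNormalised (L₂ i) := fun i q hq => by
    obtain ⟨q', -, rfl⟩ := Multiset.mem_map.1 hq
    exact nrm_nrm q'
  have hcard₂ : ∀ i, Multiset.card (L₂ i) ≤ D := fun i => by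
    rw [hL₂, Multiset.card_map]
    exact (Multiset.card_le_card (Multiset.filter_le _ _)).trans (hcard i)
  -- a sub-family of minimal size summing to `f`
  let P : Finset (Finset (Fin k)) := Finset.univ.filter fun I => ∑ i ∈ I, C (a₂ i) * (L₂ i).prod = f
  have hPu : Finset.univ ∈ P := by
    simp only [P, Finset.mem_filter, Finset.mem_univ, true_and]
    rw [hsum]; exact Finset.sum_congr rfl fun i _ => (hT i).symm
  obtain ⟨I₀, hI₀P, hI₀min⟩ := Finset.exists_min_image P Finset.card ⟨_, hPu⟩
  have hI₀ : ∑ i ∈ I₀, C (a₂ i) * (L₂ i).prod = f := (Finset.mem_filter.1 hI₀P).2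
  have hminI : ∀ J ⊆ I₀, J.Nonempty → ∑ i ∈ J, C (a₂ i) * (L₂ i).prod ≠ 0 := by
    intro J hJ hJne h0
    have hP' : I₀ \ J ∈ P := by
      simp only [P, Finset.mem_filter, Finset.mem_univ, true_and]
      have := Finset.sum_sdiff hJ (f := fun i => C (a₂ i) * (L₂ i).prod)
      rw [h0, add_zero, hI₀] at this
      exact this
    have h1 := hI₀min _ hP'
    have h2 : (I₀ \ J).card < I₀.card := Finset.card_lt_card (Finset.sdiff_ssubset hJ hJne)
    omega
  -- reindex by `Fin I₀.card`
  set m := I₀.card with hm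
  let e : Fin m ≃ I₀ := I₀.equivFin.symm
  refine ⟨⟨m, fun j => a₂ (e j), fun j => L₂ (e j), fun j => ?_, fun j => hdeg₂ _, fun j => hnrm₂ _, fun j => hcard₂ _, ?_, ?_⟩,
    ?_⟩
  · -- nonzero scalars: a zero scalar gives a vanishing singleton
    intro h0
    refine hminI {((e j) : Fin k)} (by simp) (by simp) ?_
    simp [h0]
  · -- the sum
    rw [← hI₀]
    rw [← Finset.sum_coe_sort I₀]
    exact Fintype.sum_equiv e _ _ fun j => rfl
  · -- minimality
    intro I hI h0
    refine hminI (I.map (e.toEmbedding.trans (Function.Embedding.subtype _))) ?_ ?_ ?_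
    · intro x hx
      obtain ⟨j, -, rfl⟩ := Finset.mem_map.1 hx
      exact (e j).2
    · simpa using hI
    · rw [Finset.sum_map]
      simpa using h0
  · -- size
    show m ≤ k
    rw [hm]
    exact (Finset.card_le_univ I₀).trans (by simp)

end LevelRep

end Summit.ValiantsHypothesis.ValiantsHypothesis.Theorems

end
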